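import Summits.BirchSwinnertonDyer.BirchSwinnertonDyer.Theorems.SignedLowerHalvesSmallImageLowerHalfBothSignsRttCharRoadE2JunctionMonotone
import HarnessLib

/-!
# Route `SignedLowerHalves`, crux L `SmallImageLowerHalfBothSigns` (stmt-BirchSwinnertonDyer-23599), line `rtt_w3` v14 — E2, junction row J4 (and row (4′)), LEAD:
# THE Ш-SEQUENCE SOCKET — `hY : λ(H2/f) ≤ λ(coker gX)` from an injection `H2/f ↪ 𝐇²`, an exact `Ш² → 𝐇² → Loc` with `Loc` finite, and a surjection
# `coker gX ↠ Ш²` (so the junction hand's J4 is Galois maps only); and `H1[f] = 0` from `hTF`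

WHY (BRIEF-E2 rev 5 §2 row J4, `Lines/rtt_w3-BRIEF-E2-g11.md`; LEAD `cruxlead-stmt-BirchSwinnertonDyer-23599` g11). The binder `hY` of the v15 consumer
`SmallImageRttCharRoad.charRoad_E2_of_roadD_junction_of_isUnit_nsub` (p782277) is the λ-inequality `λ(QuotSMulTop f H2) ≤ λ(X' ⧸ range gX)`; on the Galois side it comes
from three maps — `sp² : H2/f ↪ 𝐇²_{Iw,Σ}(K_∞, T*)` (base change of two-variable Iwasawa cohomology), the Poitou–Tate sequence `Ш²_Σ(T*) ↪ 𝐇²_{Iw,Σ} → ⊕_{w ∈ Σ} 𝐇²(K_{∞,w}, T*)`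
with FINITE local terms, and global duality `coker gX = Sel_str(M)^∨ ↠ Ш¹_Σ(M)^∨ ≅ Ш²_Σ(T*)`. THIS FILE is the pure-algebra assembly of those three maps into `hY`
(plain `Λ`-currency, as p779540): `λ(Y2) ≤ λ(G) = λ(ker ρ) = λ(range i) ≤ λ(Sh) ≤ λ(Y)`. It also records the one-liner of row (4′): a torsion-free module has no `f`-torsion
(`hTF ⟹ hH1` of p782277).

* `lambdaInvariant_ker_eq_of_finite_range` — `λ(ker ρ) = λ(G)` when `range ρ` is finite (quasi-isomorphism `ker ρ ↪ G`);
* `lambdaInvariant_range_le` / `lambdaInvariant_le_of_surjective'` — `λ(range i) ≤ λ(Sh)`, `λ(Sh) ≤ λ(Y)` along surjections of f.g. torsion modules (additivity p-adically,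
  tree `X2.DualRestrictionInvariants.lambdaInvariant_eq_add_of_surjective`);
* ★★ `lambdaInvariant_le_of_sha_sequence` — the J4 socket; `…_restrictScalars` — the same for `Λ_𝒪`-linear maps between modules with scalar-tower `Λ`-structures;
* `torsionBy_eq_bot_of_noZeroSMulDivisors` — row (4′): `NoZeroSMulDivisors R H1 ⟹ H1[f] = ⊥` for `f ≠ 0`.

THEOREMS ONLY (`--supports stmt-BirchSwinnertonDyer-23599` helper); closes nothing; crux L, crux M, E2 and BSD remain OPEN and are proved for NO curve by any of this.
[cite: Washington1997, §13.2] [cite: Kobayashi2003, Thm. 7.3 i)] [cite: NeukirchSchmidtWingberg2008, Ch. VIII §6 (8.6.10) (Poitou–Tate sequence)]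
-/

set_option autoImplicit false
-- the Theorems namespace of this sub repeats the summit name by design (D-0017 nested layout)
set_option linter.dupNamespace false

noncomputable section

open Literature.NumberTheory.EllipticCurves Literature.NumberTheory.EllipticCurves.IwasawaDual
open Summit.BirchSwinnertonDyer.Rank1Residual.X2.DualRestrictionInvariants (lambdaInvariant_eq_add_of_surjective)

namespace Summit.BirchSwinnertonDyer.BirchSwinnertonDyer.Theorems.SmallImageRttCharRoad

universe u₁ u₂ u₃ u₄ u₅

variable {p : ℕ} [Fact p.Prime]

/-! ## §1 Plain `Λ`-currency -/

section Lambda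

variable {Y2 : Type u₁} {G : Type u₂} {Sh : Type u₃} {Loc : Type u₄} {Y : Type u₅}
  [AddCommGroup Y2] [Module (IwasawaAlgebra p) Y2] [AddCommGroup G] [Module (IwasawaAlgebra p) G]
  [AddCommGroup Sh] [Module (IwasawaAlgebra p) Sh] [AddCommGroup Loc] [Module (IwasawaAlgebra p) Loc]
  [AddCommGroup Y] [Module (IwasawaAlgebra p) Y]

/-- **`λ(ker ρ) = λ(G)` when `range ρ` is finite**: `ker ρ ↪ G` has finite cokernel `G ⧸ ker ρ ≅ range ρ`. [cite: Washington1997, §13.2] [folklore] -/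
theorem lambdaInvariant_ker_eq_of_finite_range (ρ : G →ₗ[IwasawaAlgebra p] Loc) (hρ : Finite (LinearMap.range ρ)) :
    lambdaInvariant p (LinearMap.ker ρ) = lambdaInvariant p G := by
  refine lambdaInvariant_eq_of_finite_ker_coker (LinearMap.ker ρ).subtype ?_ ?_
  · rw [Submodule.ker_subtype]; infer_instance
  · rw [Submodule.range_subtype]
    exact Finite.of_equiv _ ρ.quotKerEquivRange.symm.toEquiv

/-- **`λ(range i) ≤ λ(Sh)`** for `i : Sh → G` with `Sh` finitely generated torsion (`range i` is a quotient of `Sh`). [cite: Washington1997, §13.2] [folklore] -/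
theorem lambdaInvariant_range_le (i : Sh →ₗ[IwasawaAlgebra p] G) [Module.Finite (IwasawaAlgebra p) Sh]
    (hSh : Module.IsTorsion (IwasawaAlgebra p) Sh) : lambdaInvariant p (LinearMap.range i) ≤ lambdaInvariant p Sh := by
  have h := lambdaInvariant_eq_add_of_surjective p i.rangeRestrict hSh (LinearMap.surjective_rangeRestrict i)
  omega

/-- **`λ(Sh) ≤ λ(Y)` along a surjection `Y ↠ Sh`** with `Y` finitely generated torsion. [cite: Washington1997, §13.2] [folklore] -/
theorem lambdaInvariant_le_of_surjective' (π : Y →ₗ[IwasawaAlgebra p] Sh) (hπ : Function.Surjective π) [Module.Finite (IwasawaAlgebra p) Y]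
    (hY : Module.IsTorsion (IwasawaAlgebra p) Y) : lambdaInvariant p Sh ≤ lambdaInvariant p Y := by
  have h := lambdaInvariant_eq_add_of_surjective p π hY hπ
  omega

/-- ★★ **The Ш-sequence socket (row J4).** `Λ`-modules `Y2` (= `H2/f`), `G` (= `𝐇²_{Iw,Σ}(K_∞,T*)`), `Sh` (= `Ш²_Σ(T*)`), `Loc` (= `⊕_{w∈Σ} 𝐇²(K_{∞,w},T*)`),
`Y` (= `coker gX = Sel_str^∨`); maps `e : Y2 ↪ G` injective with `G` f.g. torsion, `i : Sh → G`, `ρ : G → Loc` exact at `G` with `range ρ` finite, `Sh` f.g. torsion,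
`π : Y ↠ Sh` with `Y` f.g. torsion. Then `λ(Y2) ≤ λ(Y)` — the binder `hY` of `charRoad_E2_of_roadD_junction_of_isUnit_nsub`.
[cite: Washington1997, §13.2] [cite: NeukirchSchmidtWingberg2008, Ch. VIII §6 (8.6.10)] -/
theorem lambdaInvariant_le_of_sha_sequence (e : Y2 →ₗ[IwasawaAlgebra p] G) (he : Function.Injective e)
    [Module.Finite (IwasawaAlgebra p) G] (hG : Module.IsTorsion (IwasawaAlgebra p) G)
    (i : Sh →ₗ[IwasawaAlgebra p] G) (ρ : G →ₗ[IwasawaAlgebra p] Loc) (hex : Function.Exact i ρ) (hρ : Finite (LinearMap.range ρ))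
    [Module.Finite (IwasawaAlgebra p) Sh] (hSh : Module.IsTorsion (IwasawaAlgebra p) Sh)
    (π : Y →ₗ[IwasawaAlgebra p] Sh) (hπ : Function.Surjective π) [Module.Finite (IwasawaAlgebra p) Y] (hY : Module.IsTorsion (IwasawaAlgebra p) Y) :
    lambdaInvariant p Y2 ≤ lambdaInvariant p Y := by
  have h1 : lambdaInvariant p Y2 ≤ lambdaInvariant p G := lambdaInvariant_le_of_injective_of_isTorsion e he hG
  have h2 : lambdaInvariant p G = lambdaInvariant p (LinearMap.range i) := by
    rw [← lambdaInvariant_ker_eq_of_finite_range ρ hρ, LinearMap.exact_iff.mp hex]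
  exact h1.trans (h2.le.trans ((lambdaInvariant_range_le i hSh).trans (lambdaInvariant_le_of_surjective' π hπ hY)))

/-- Variant with `Loc` itself finite. [cite: Washington1997, §13.2] -/
theorem lambdaInvariant_le_of_sha_sequence_of_finite (e : Y2 →ₗ[IwasawaAlgebra p] G) (he : Function.Injective e)
    [Module.Finite (IwasawaAlgebra p) G] (hG : Module.IsTorsion (IwasawaAlgebra p) G)
    (i : Sh →ₗ[IwasawaAlgebra p] G) (ρ : G →ₗ[IwasawaAlgebra p] Loc) (hex : Function.Exact i ρ) [Finite Loc]
    [Module.Finite (IwasawaAlgebra p) Sh] (hSh : Module.IsTorsion (IwasawaAlgebra p) Sh)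
    (π : Y →ₗ[IwasawaAlgebra p] Sh) (hπ : Function.Surjective π) [Module.Finite (IwasawaAlgebra p) Y] (hY : Module.IsTorsion (IwasawaAlgebra p) Y) :
    lambdaInvariant p Y2 ≤ lambdaInvariant p Y :=
  lambdaInvariant_le_of_sha_sequence e he hG i ρ hex (Finite.of_injective _ (LinearMap.range ρ).subtype_injective) hSh π hπ hY

end Lambda

/-! ## §2 `Λ_𝒪`-linear maps with scalar-tower `Λ`-structures -/

section LambdaO

variable {S : Set (PadicAlgCl p)} [Algebra (IwasawaAlgebra p) (IwasawaAlgebraO S)]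
  {Y2 : Type u₁} {G : Type u₂} {Sh : Type u₃} {Loc : Type u₄} {Y : Type u₅}
  [AddCommGroup Y2] [Module (IwasawaAlgebraO S) Y2] [Module (IwasawaAlgebra p) Y2] [IsScalarTower (IwasawaAlgebra p) (IwasawaAlgebraO S) Y2]
  [AddCommGroup G] [Module (IwasawaAlgebraO S) G] [Module (IwasawaAlgebra p) G] [IsScalarTower (IwasawaAlgebra p) (IwasawaAlgebraO S) G]
  [AddCommGroup Sh] [Module (IwasawaAlgebraO S) Sh] [Module (IwasawaAlgebra p) Sh] [IsScalarTower (IwasawaAlgebra p) (IwasawaAlgebraO S) Sh]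
  [AddCommGroup Loc] [Module (IwasawaAlgebraO S) Loc] [Module (IwasawaAlgebra p) Loc] [IsScalarTower (IwasawaAlgebra p) (IwasawaAlgebraO S) Loc]
  [AddCommGroup Y] [Module (IwasawaAlgebraO S) Y] [Module (IwasawaAlgebra p) Y] [IsScalarTower (IwasawaAlgebra p) (IwasawaAlgebraO S) Y]

/-- ★★ **The Ш-sequence socket for `Λ_𝒪`-linear maps** (restriction of scalars to `Λ`). [cite: Washington1997, §13.2] [cite: NeukirchSchmidtWingberg2008, Ch. VIII §6 (8.6.10)] -/
theorem lambdaInvariant_le_of_sha_sequence_restrictScalars (e : Y2 →ₗ[IwasawaAlgebraO S] G) (he : Function.Injective e)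
    [Module.Finite (IwasawaAlgebra p) G] (hG : Module.IsTorsion (IwasawaAlgebra p) G)
    (i : Sh →ₗ[IwasawaAlgebraO S] G) (ρ : G →ₗ[IwasawaAlgebraO S] Loc) (hex : Function.Exact i ρ) (hρ : Finite (LinearMap.range ρ))
    [Module.Finite (IwasawaAlgebra p) Sh] (hSh : Module.IsTorsion (IwasawaAlgebra p) Sh)
    (π : Y →ₗ[IwasawaAlgebraO S] Sh) (hπ : Function.Surjective π) [Module.Finite (IwasawaAlgebra p) Y] (hY : Module.IsTorsion (IwasawaAlgebra p) Y) :
    lambdaInvariant p Y2 ≤ lambdaInvariant p Y := by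
  refine lambdaInvariant_le_of_sha_sequence (e.restrictScalars (IwasawaAlgebra p)) he hG (i.restrictScalars (IwasawaAlgebra p))
    (ρ.restrictScalars (IwasawaAlgebra p)) hex ?_ hSh (π.restrictScalars (IwasawaAlgebra p)) hπ hY
  have hr : (LinearMap.range (ρ.restrictScalars (IwasawaAlgebra p)) : Set Loc) = LinearMap.range ρ := by
    ext x; simp only [SetLike.mem_coe, LinearMap.mem_range, LinearMap.coe_restrictScalars]
  exact (Set.finite_coe_iff.mpr ((Set.finite_coe_iff.mp hρ).subset hr.symm.subset))

end LambdaO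

/-! ## §3 Row (4′): a torsion-free module has no `f`-torsion -/

/-- **`NoZeroSMulDivisors R M ⟹ M[f] = ⊥` for `f ≠ 0`** — row (4′) of BRIEF-E2 rev 5: honda's `hTF : NoZeroSMulDivisors Λ_{𝒪,2} D.D1.H` gives the binder
`hH1 : D.D1.H[f] = ⊥` of `charRoad_E2_of_roadD_junction_of_isUnit_nsub` (p782277). [folklore] -/
theorem torsionBy_eq_bot_of_noZeroSMulDivisors {R : Type u₁} [CommRing R] {M : Type u₂} [AddCommGroup M] [Module R M] [NoZeroSMulDivisors R M]
    {f : R} (hf : f ≠ 0) : Submodule.torsionBy R M f = ⊥ := by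
  refine (Submodule.eq_bot_iff _).mpr fun x hx ↦ ?_
  exact (eq_zero_or_eq_zero_of_smul_eq_zero ((Submodule.mem_torsionBy_iff f x).mp hx)).resolve_left hf

end Summit.BirchSwinnertonDyer.BirchSwinnertonDyer.Theorems.SmallImageRttCharRoad

end
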